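import Summits.Ventures.PercRepro.C041BlockMapUnit
import Summits.Ventures.PercRepro.C041BlockMapFourCores

/-!
# ROW C-041 — AN EXIT AT THE ANCHOR MULTIPLIES: `Θ_{Z, u + a}(X, w) = X · Θ_{Z, u}(w)`, and the two diamonds
with an inner vertex of degree `2` on an anchor edge reduce to the triangle (p6, gen 36)

Setting of `C041BlockMapUnit` (the extra exit `uplus u v`, the inputs `wplus X w`, the bookkeeping of the merged
set and the blocks of the extra exit) and `C041BlockMapFourCores` (the triangle with an edge doubled and one copy
subdivided).  THEOREM (ANCHOR EXIT) (`blockMap_uplus_anchor`): an exit placed AT the anchor is merged and reached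
under every colouring, so its input multiplies the block map: `blockMap Z (uplus u a) a (wplus X w) = X *
blockMap Z u a w` — the merged set of the extra exit is `insertNone` of the old one (`merged_uplus_anchor`), the
blocks do not see it (`none_notMem_of_mem_blocks_anchor`, then `prod_blocks_uplus`).  Hence CONJECTURE (BLOCK
MAP) is closed under adding an exit at the anchor (`coneHost_uplus_anchor`, the cone is closed under products).
APPLICATION: the triangle with an ANCHOR edge doubled and one copy replaced by a path (the diamonds whose inner
vertex of degree `2` is adjacent to the anchor and to one exit — `K₄ − u′3` and `K₄ − u3` in the vocabulary of
`C041BlockMapFourCores`) is a cone host as soon as the triangle is (`coneHost_triDupPath0_of_tri`,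
`coneHost_triDupPath2_of_tri`): `Built.dup` needs the contraction along the anchor edge, whose exits are the
other exit and the anchor itself — a one-exit host with an exit added at the anchor.  With
`coneHost_triDupPath_of_tri` (the exit edge) every two-exit host on four vertices whose inner vertex has degree
`2` reduces to the triangle.
-/

namespace PercRepro

namespace ZoneZ

namespace MultiExit

open ZoneData Pendant Finset TwoExit TreeClosure

section Anchor

variable {ι V₁ E₁ U₁ U₂ : Type} (Z₁ : ZoneData V₁ E₁ U₁ U₂) (u : ι → V₁) (a₁ : V₁) [Fintype ι] [DecidableEq ι]
  (ω : E₁ → Bool)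

/-- A vertex is reached from itself. -/
theorem Rd_self (v : V₁) : Z₁.Rd v v ω := by
  rw [Rd_iff_reflTransGen]

omit [DecidableEq ι] in
/-- The merged set of the exits with an extra exit at the anchor: the old merged set with the extra exit. -/
theorem merged_uplus_anchor : merged Z₁ (uplus u a₁) a₁ ω = Finset.insertNone (merged Z₁ u a₁ ω) := by
  ext o
  rw [mem_merged, Finset.mem_insertNone]
  cases o with
  | none =>
    rw [uplus_none]
    exact ⟨fun _ a ha => absurd ha (by simp), fun _ => Mg_refl Z₁ ω a₁⟩
  | some k =>
    rw [uplus_some]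
    constructor
    · intro h a ha
      rw [Option.mem_def, Option.some.injEq] at ha
      rw [← ha, mem_merged]
      exact h
    · intro h
      have := h k rfl
      rwa [mem_merged] at this

omit [DecidableEq ι] in
/-- The extra exit at the anchor lies in no block. -/
theorem none_notMem_of_mem_blocks_anchor {B : Finset (Option ι)} (hB : B ∈ blocks Z₁ (uplus u a₁) a₁ ω) :
    none ∉ B := by
  rw [mem_blocks] at hB
  obtain ⟨o, -, rfl⟩ := hB
  rw [mem_blk, uplus_none]
  rintro ⟨h, -⟩
  exact h (Mg_refl Z₁ ω a₁)

/-- The colouring term with an extra exit at the anchor: the input of that exit times the old term. -/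
theorem colTerm_uplus_anchor (w : ι → Vec6) (X : Vec6) :
    colTerm Z₁ (uplus u a₁) a₁ ω (wplus X w) = X * colTerm Z₁ u a₁ ω w := by
  classical
  unfold colTerm
  rw [merged_uplus_anchor, Finset.prod_insertNone]
  have hb : ∏ B ∈ blocks Z₁ (uplus u a₁) a₁ ω, thR (∏ o ∈ B, exitOf (wplus X w o) (Z₁.Rd a₁ (uplus u a₁ o) ω)) =
      ∏ B ∈ blocks Z₁ (uplus u a₁) a₁ ω, thR (∏ o ∈ B, exitOf (wplus 1 w o) (Z₁.Rd a₁ (uplus u a₁ o) ω)) := by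
    refine Finset.prod_congr rfl fun B hB => ?_
    congr 1
    refine Finset.prod_congr rfl fun o ho => ?_
    cases o with
    | none => exact absurd ho (none_notMem_of_mem_blocks_anchor Z₁ u a₁ ω hB)
    | some k => rfl
  rw [hb, prod_blocks_uplus Z₁ u a₁ a₁ ω _ (by rw [wplus_none, exitOf_one])]
  simp only [wplus_none, wplus_some, uplus_none, uplus_some]
  unfold exitOf
  rw [if_pos (Rd_self Z₁ ω a₁), mul_assoc]

variable [Fintype E₁] [DecidableEq E₁]

/-- **THEOREM (ANCHOR EXIT)**: an exit at the anchor multiplies the block map by its input. -/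
theorem blockMap_uplus_anchor (w : ι → Vec6) (X : Vec6) :
    blockMap Z₁ (uplus u a₁) a₁ (wplus X w) = X * blockMap Z₁ u a₁ w := by
  rw [blockMap_eq_sum_colTerm, blockMap_eq_sum_colTerm, Finset.mul_sum]
  exact Finset.sum_congr rfl fun ω _ => colTerm_uplus_anchor Z₁ u a₁ ω w X

omit [Fintype ι] [DecidableEq ι] [Fintype E₁] [DecidableEq E₁] in
/-- The inputs of an extra exit are the input of that exit with the old inputs. -/
theorem wplus_eta (w : Option ι → Vec6) : w = wplus (w none) fun k => w (some k) := by
  funext o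
  cases o <;> rfl

/-- **CONJECTURE (BLOCK MAP) is closed under adding an exit at the anchor.** -/
theorem coneHost_uplus_anchor (h : ConeHost Z₁ u a₁) : ConeHost Z₁ (uplus u a₁) a₁ := by
  intro w hw
  rw [wplus_eta w, blockMap_uplus_anchor]
  exact (hw none).mul (h _ fun k => hw (some k))

end Anchor

/-! ## The diamonds with an inner vertex of degree `2` on an anchor edge -/

/-- `inl () ↦ none`, `inr () ↦ some ()`. -/
def sumEquivOption : Unit ⊕ Unit ≃ Option Unit where
  toFun := Sum.elim (fun _ => none) fun _ => some ()
  invFun := fun o => o.elim (Sum.inl ()) fun _ => Sum.inr ()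
  left_inv := by decide
  right_inv := by decide

/-- `inl () ↦ some ()`, `inr () ↦ none`. -/
def sumEquivOption' : Unit ⊕ Unit ≃ Option Unit where
  toFun := Sum.elim (fun _ => some ()) fun _ => none
  invFun := fun o => o.elim (Sum.inr ()) fun _ => Sum.inl ()
  left_inv := by decide
  right_inv := by decide

/-- The triangle contracted along the anchor edge `0 → 1`: the exits are the anchor and the vertex `2`. -/
theorem triExit_contract0 :
    (fun k => redC (tri.fst 0) (tri.snd 0) (triExit k)) = uplus (fun _ : Unit => (2 : Fin 3)) 0 ∘ sumEquivOption := by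
  funext k
  rcases k with ⟨⟩ | ⟨⟩ <;> rfl

/-- The triangle contracted along the anchor edge `2 → 0`: the anchor becomes `2`, the exits are `1` and `2`. -/
theorem triExit_contract2 :
    (fun k => redC (tri.fst 2) (tri.snd 2) (triExit k)) = uplus (fun _ : Unit => (1 : Fin 3)) 2 ∘ sumEquivOption' := by
  funext k
  rcases k with ⟨⟩ | ⟨⟩ <;> rfl

/-- **The diamond `K₄ − u′3` reduces to the triangle**: the triangle with its anchor edge `0 → 1` doubled and one
copy replaced by a path with `n` internal vertices is a cone host as soon as the triangle is. -/
theorem coneHost_triDupPath0_of_tri (h : ConeHost tri triExit 0) (n : ℕ) :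
    ConeHost (pathHost (dup tri 0) none n) (fun k => Sum.inl (triExit k)) (Sum.inl 0) := by
  refine coneHost_of_built (Built.path _ none n triExit 0 ?_ ?_)
  · refine Built.dup tri 0 triExit 0 (Built.core _ _ _ h) ?_
    rw [triExit_contract0]
    exact Built.core _ _ _ (coneHost_reindex _ (coneHost_uplus_anchor _ _ _ (coneHost_oneExit _ _ _)))
  · rw [loopify_dup_none]
    exact Built.addLoop tri _ triExit 0 (Built.core _ _ _ h)

/-- **The diamond `K₄ − u3` reduces to the triangle**: the triangle with its anchor edge `2 → 0` doubled and one
copy replaced by a path with `n` internal vertices is a cone host as soon as the triangle is. -/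
theorem coneHost_triDupPath2_of_tri (h : ConeHost tri triExit 0) (n : ℕ) :
    ConeHost (pathHost (dup tri 2) none n) (fun k => Sum.inl (triExit k)) (Sum.inl 0) := by
  refine coneHost_of_built (Built.path _ none n triExit 0 ?_ ?_)
  · refine Built.dup tri 2 triExit 0 (Built.core _ _ _ h) ?_
    rw [triExit_contract2]
    exact Built.core _ _ _ (coneHost_reindex _ (coneHost_uplus_anchor _ _ _ (coneHost_oneExit _ _ _)))
  · rw [loopify_dup_none]
    exact Built.addLoop tri _ triExit 0 (Built.core _ _ _ h)

end MultiExit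

end ZoneZ

end PercRepro
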